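import Summits.QuantumFields.YangMills.Theorems.LuscherReductionDressedRitzPolyakovLiftTransplantRoot
import Mathlib.MeasureTheory.Measure.Haar.OfBasis
import HarnessLib

/-!
# Line «polyakovlift» r6 on crux `DressedRitz` (stmt-QuantumFields-20205): REGULARITY AND A SECTION OF THE ROOT CHART `rootCoord L μ`

Fleet-service module of seat ym-infvol-p1 g7 (route `LuscherReduction`, femto rung R2b1; S-STAT `stub_liftStatics`, skeleton r6 `09c950a55cd7b1f3`).  The registered
observables `g_i = (χ_R f_{i+1}/f_0) ∘ rootCoord L (Λ/2)` (tree `…PolyakovLiftTransplantRoot`, p554989) are read through the gnomonic chart, which is discontinuous on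
the equator `scalarPart = 0`.  On the REGULAR SET — all three links in the open upper cap with non-zero gnomonic radius — everything is continuous and the chart
has an explicit section:

* `continuousAt_gnCoord`, `continuousAt_rootProfile` (away from `r = 0`), `continuous_linkNormSq`, `continuousAt_rootRescale`, ★ `continuousAt_transplantObsL`;
* ★ `exists_regular_preimage_rootCoord` — for `L ≥ 1`, `μ > 0` and `y` with non-zero link vectors, `μ|y_i| < π/2`: a regular `W` with `rootCoord L μ W = y`
  (`W_i = P(1, tan(L·arctan(μ|y_i|/L))·y_i/|y_i|)`, using `gnLink_gnoPoint` and `tan ∘ arctan`);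
* `sqrt_linkNormSq_le_norm`; `exists_regular_point` — a non-empty open subset of `ℝ⁹` contains a point with non-zero link vectors (coordinate hyperplanes
  are Lebesgue-null, `Measure.addHaar_submodule`).

Used by `…TransplantPositivity.lean` (clause (o0) of S-STAT″ for every `TransplantBasisL` basis) and available to the W2-F8 Lipschitz analysis of the shadow
observable.  HONEST FRAMING: fixed chart bookkeeping; nothing here bears on infinite volume, the continuum limit or the Clay gap.
References: M. Lüscher, NPB 219 (1983) 233 [cite: Luscher1983, §2]; Bröcker–tom Dieck [cite: BrockerTomDieck1985, I (1.10)].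
-/

set_option autoImplicit false

noncomputable section

open MeasureTheory Filter Topology Real
open Literature.MathematicalPhysics.QuantumFieldTheory (GaugeConfig Site gaugeTransform wilsonFlow continuous_wilsonFlow)
open Literature.Analysis.OperatorTheory.YMMatrixModel
open Literature.MathematicalPhysics.QuantumFieldTheory.Balaban1983to89.T4CubeChartGnomonic (gnoPoint)
open scoped BigOperators ENNReal

namespace Summit.QuantumFields.YangMills.Theorems.FemtoTransferGap.PolyakovLift

open Summit.QuantumFields.YangMills.Theorems.FemtoTransferGap

/-! ## §1 Regularity of the root chart on the open cap with non-zero gnomonic radius -/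

/-- `gnCoord μ` is continuous at every configuration whose links lie in the open upper cap (`scalarPart ≠ 0`). [folklore] -/
theorem continuousAt_gnCoord (μ : ℝ) {U : Cfg} (hU : ∀ i : Fin 3, scalarPart (U (edgeOf i)) ≠ 0) : ContinuousAt (gnCoord μ) U := by
  have h : gnCoord μ = (WithLp.toLp 2) ∘ fun (U : Cfg) (p : Fin 3 × Fin 3) => gnLink (U (edgeOf p.1)) p.2 / μ := rfl
  rw [h]
  refine (PiLp.continuous_toLp 2 _).continuousAt.comp (continuousAt_pi.2 fun p => ?_)
  have h1 : ContinuousAt (fun U : Cfg => vecPart (U (edgeOf p.1)) p.2) U :=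
    ((continuous_apply p.2).comp (continuous_vecPart.comp (continuous_apply (edgeOf p.1)))).continuousAt
  have h2 : ContinuousAt (fun U : Cfg => scalarPart (U (edgeOf p.1))) U :=
    (continuous_scalarPart.comp (continuous_apply (edgeOf p.1))).continuousAt
  exact (h1.div h2 (hU p.1)).div_const μ

/-- The root profile is continuous away from `r = 0`. [folklore] -/
theorem continuousAt_rootProfile (L : ℕ) {r : ℝ} (hr : r ≠ 0) : ContinuousAt (rootProfile L) r := by
  have hev : (fun s => (L : ℝ) * Real.tan (Real.arctan s / L) / s) =ᶠ[𝓝 r] rootProfile L := by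
    filter_upwards [eventually_ne_nhds hr] with s hs
    rw [rootProfile, if_neg hs]
  refine ContinuousAt.congr ?_ hev
  have hcos : Real.cos (Real.arctan r / L) ≠ 0 := by
    refine (Real.cos_pos_of_mem_Ioo ⟨?_, ?_⟩).ne'
    · have h1 := Real.neg_pi_div_two_lt_arctan r
      rcases Nat.eq_zero_or_pos L with hL | hL
      · simp [hL, Real.pi_pos]
      · have hL1 : (1 : ℝ) ≤ L := by exact_mod_cast hL
        have : |Real.arctan r / L| ≤ |Real.arctan r| := by
          rw [abs_div, abs_of_pos (by positivity : (0 : ℝ) < L)]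
          exact div_le_self (abs_nonneg _) hL1
        have h2 := Real.arctan_lt_pi_div_two r
        have h3 : |Real.arctan r| < π / 2 := abs_lt.2 ⟨h1, h2⟩
        linarith [(abs_lt.1 (this.trans_lt h3)).1]
    · rcases Nat.eq_zero_or_pos L with hL | hL
      · simp [hL, Real.pi_pos]
      · have hL1 : (1 : ℝ) ≤ L := by exact_mod_cast hL
        have : |Real.arctan r / L| ≤ |Real.arctan r| := by
          rw [abs_div, abs_of_pos (by positivity : (0 : ℝ) < L)]
          exact div_le_self (abs_nonneg _) hL1
        have h3 : |Real.arctan r| < π / 2 := abs_lt.2 ⟨Real.neg_pi_div_two_lt_arctan r, Real.arctan_lt_pi_div_two r⟩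
        linarith [(abs_lt.1 (this.trans_lt h3)).2]
  have hf : ContinuousAt (fun s : ℝ => Real.arctan s / (L : ℝ)) r := Real.continuous_arctan.continuousAt.div_const _
  have htan : ContinuousAt (fun s => Real.tan (Real.arctan s / L)) r :=
    ContinuousAt.comp (g := Real.tan) (f := fun s : ℝ => Real.arctan s / (L : ℝ)) (Real.continuousAt_tan.2 hcos) hf
  exact ((continuousAt_const.mul htan).div continuousAt_id hr)

/-- `linkNormSq` is continuous. [folklore] -/
theorem continuous_linkNormSq (i : Fin 3) : Continuous fun y : ZM => linkNormSq y i := by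
  unfold linkNormSq
  exact continuous_finsetSum _ fun a _ => (PiLp.continuous_apply 2 _ (i, a)).pow 2

/-- `rootRescale L μ` (`μ > 0`) is continuous at every `y` all of whose link vectors are non-zero. [folklore] -/
theorem continuousAt_rootRescale (L : ℕ) {μ : ℝ} (hμ : 0 < μ) {y : ZM} (hy : ∀ i, 0 < linkNormSq y i) : ContinuousAt (rootRescale L μ) y := by
  have h : rootRescale L μ = (WithLp.toLp 2) ∘ fun (y : ZM) (p : Fin 3 × Fin 3) =>
      rootProfile L (μ * Real.sqrt (linkNormSq y p.1)) * y p := rfl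
  rw [h]
  refine (PiLp.continuous_toLp 2 _).continuousAt.comp (continuousAt_pi.2 fun p => ?_)
  have hr : μ * Real.sqrt (linkNormSq y p.1) ≠ 0 := (mul_pos hμ (Real.sqrt_pos.2 (hy p.1))).ne'
  have h1 : ContinuousAt (fun y : ZM => μ * Real.sqrt (linkNormSq y p.1)) y :=
    (continuous_const.mul ((continuous_linkNormSq p.1).sqrt)).continuousAt
  have h2 : ContinuousAt (fun y : ZM => rootProfile L (μ * Real.sqrt (linkNormSq y p.1))) y :=
    ContinuousAt.comp (g := rootProfile L) (continuousAt_rootProfile L hr) h1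
  exact h2.mul (PiLp.continuous_apply 2 _ p).continuousAt

/-- ★ **Continuity of the transplanted observables on the regular set**: `g_i = transplantObsL L Λ R f i` is continuous at every configuration whose three
links lie in the open upper cap with non-zero gnomonic radius. [cite: Luscher1983, §2–§3] -/
theorem continuousAt_transplantObsL {k : ℕ} {f : Fin (k + 1) → ZM → ℝ} (hf : IsEigenFamily k f) (hpos : ∀ x, 0 < f 0 x) (R : ℝ)
    {Λ : ℝ} (hΛ : 0 < Λ) (L : ℕ) (i : Fin k) {U : Cfg} (hU : ∀ j : Fin 3, 0 < scalarPart (U (edgeOf j)) ∧ 0 < gnNorm (U (edgeOf j))) :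
    ContinuousAt (transplantObsL L Λ R f i) U := by
  have h1 : ContinuousAt (gnCoord (Λ / 2)) U := continuousAt_gnCoord _ fun j => (hU j).1.ne'
  have h2 : ContinuousAt (rootRescale L (Λ / 2)) (gnCoord (Λ / 2) U) := by
    refine continuousAt_rootRescale L (half_pos hΛ) fun j => ?_
    rw [linkNormSq_gnCoord]
    have hsum : 0 < ∑ a : Fin 3, gnLink (U (edgeOf j)) a ^ 2 := by
      have h := (hU j).2
      rw [gnNorm] at h
      exact Real.sqrt_pos.1 h
    exact div_pos hsum (pow_pos (half_pos hΛ) 2)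
  have h3 : ContinuousAt (rootCoord L (Λ / 2)) U := ContinuousAt.comp (g := rootRescale L (Λ / 2)) h2 h1
  exact ContinuousAt.comp (g := transplantFn R f i) (continuous_transplantFn R hf hpos i).continuousAt h3

/-! ## §2 A section of the root chart on the regular set -/

/-- `(edgeOf j).2 = j`. [folklore] -/
theorem edgeOf_snd' (j : Fin 3) : (edgeOf j).2 = j := rfl

/-- For `0 < y < π/2`: `arctan y < y`... in the form needed: `0 < x → arctan x < x`. [folklore] -/
theorem arctan_lt_self {x : ℝ} (hx : 0 < x) : Real.arctan x < x := by
  have h1 : 0 < Real.arctan x := Real.arctan_pos.mpr hx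
  have h := Real.lt_tan h1 (Real.arctan_lt_pi_div_two x)
  rwa [Real.tan_arctan] at h

/-- ★ **Section of the root chart.**  For `L ≥ 1`, `μ > 0` and `y ∈ ℝ⁹` all of whose link vectors `y_i` are non-zero with `μ|y_i| < π/2`, there is a REGULAR
configuration `W` (links in the open upper cap, non-zero gnomonic radius) with `rootCoord L μ W = y`:
`W_i = P(1, tan(L·arctan(μ|y_i|/L)) · y_i/|y_i|)`. [cite: Luscher1983, §2] -/
theorem exists_regular_preimage_rootCoord {L : ℕ} (hL : 1 ≤ L) {μ : ℝ} (hμ : 0 < μ) {y : ZM} (hy : ∀ i, 0 < linkNormSq y i)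
    (hyμ : ∀ i, μ * Real.sqrt (linkNormSq y i) < π / 2) :
    ∃ W : Cfg, (∀ j : Fin 3, 0 < scalarPart (W (edgeOf j)) ∧ 0 < gnNorm (W (edgeOf j))) ∧ rootCoord L μ W = y := by
  have hL0 : (0 : ℝ) < L := by exact_mod_cast hL
  have hL1 : (1 : ℝ) ≤ L := by exact_mod_cast hL
  -- per-link data
  set s : Fin 3 → ℝ := fun i => Real.sqrt (linkNormSq y i) with hs_def
  have hs : ∀ i, 0 < s i := fun i => Real.sqrt_pos.2 (hy i)
  have hs2 : ∀ i, s i ^ 2 = linkNormSq y i := fun i => Real.sq_sqrt (hy i).le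
  set θ : Fin 3 → ℝ := fun i => (L : ℝ) * Real.arctan (μ * s i / L) with hθ_def
  have hθpos : ∀ i, 0 < θ i := fun i => mul_pos hL0 (Real.arctan_pos.mpr (div_pos (mul_pos hμ (hs i)) hL0))
  have hθlt : ∀ i, θ i < π / 2 := fun i => by
    have h1 : Real.arctan (μ * s i / L) < μ * s i / L := arctan_lt_self (div_pos (mul_pos hμ (hs i)) hL0)
    have h2 : θ i < (L : ℝ) * (μ * s i / L) := mul_lt_mul_of_pos_left h1 hL0
    rw [mul_div_cancel₀ _ hL0.ne'] at h2
    exact h2.trans (hyμ i)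
  have hθlt' : ∀ i, -(π / 2) < θ i := fun i => by linarith [hθpos i, Real.pi_pos]
  set t : Fin 3 → ℝ := fun i => Real.tan (θ i) with ht_def
  have ht : ∀ i, 0 < t i := fun i => Real.tan_pos_of_pos_of_lt_pi_div_two (hθpos i) (hθlt i)
  have harctan_t : ∀ i, Real.arctan (t i) = θ i := fun i => Real.arctan_tan (hθlt' i) (hθlt i)
  -- `L·tan(θ_i/L) = μ s_i`
  have hroot : ∀ i, (L : ℝ) * Real.tan (θ i / L) = μ * s i := fun i => by
    have : θ i / L = Real.arctan (μ * s i / L) := by rw [hθ_def]; field_simp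
    rw [this, Real.tan_arctan]
    field_simp
  -- the section
  set v : Fin 3 → Fin 3 → ℝ := fun i a => t i / s i * y (i, a) with hv_def
  refine ⟨fun e => gnoPoint (v e.2), fun j => ⟨?_, ?_⟩, ?_⟩
  · exact scalarPart_gnoPoint_pos _
  · -- `|gn W_j| = t_j`
    show 0 < gnNorm (gnoPoint (v (edgeOf j).2))
    rw [edgeOf_snd', gnNorm, gnLink_gnoPoint]
    have hsj : s j ≠ 0 := (hs j).ne'
    have : ∑ a, v j a ^ 2 = t j ^ 2 := by
      simp only [hv_def, mul_pow, ← Finset.mul_sum]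
      rw [← show linkNormSq y j = ∑ a, y (j, a) ^ 2 from rfl, ← hs2 j, div_pow]
      field_simp
    rw [this, Real.sqrt_sq (ht j).le]
    exact ht j
  · -- `rootCoord L μ W = y`
    have hgn : ∀ p : Fin 3 × Fin 3, gnCoord μ (fun e => gnoPoint (v e.2)) p = t p.1 / s p.1 * y p / μ := fun p => by
      rw [gnCoord_apply]
      show gnLink (gnoPoint (v (edgeOf p.1).2)) p.2 / μ = _
      rw [edgeOf_snd', gnLink_gnoPoint]
    have hns : ∀ i, linkNormSq (gnCoord μ (fun e => gnoPoint (v e.2))) i = (t i / μ) ^ 2 := fun i => by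
      have hsi : s i ≠ 0 := (hs i).ne'
      have hμ0 : μ ≠ 0 := hμ.ne'
      unfold linkNormSq
      simp only [hgn]
      have e : ∑ a, (t i / s i * y (i, a) / μ) ^ 2 = (t i / (s i * μ)) ^ 2 * ∑ a, y (i, a) ^ 2 := by
        rw [Finset.mul_sum]
        exact Finset.sum_congr rfl fun a _ => by field_simp
      rw [e, ← show linkNormSq y i = ∑ a, y (i, a) ^ 2 from rfl, ← hs2 i]
      field_simp
    ext p
    have hsp : s p.1 ≠ 0 := (hs p.1).ne'
    have htp : t p.1 ≠ 0 := (ht p.1).ne'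
    rw [rootCoord, rootRescale_apply, hns, Real.sqrt_sq (div_pos (ht p.1) hμ).le, mul_div_cancel₀ _ hμ.ne', hgn,
      rootProfile, if_neg (ht p.1).ne', harctan_t, hroot]
    field_simp

/-! ## §3 Regular points -/

/-- The link norm is at most the total norm: `√(Σ_a y_{(j,a)}²) ≤ ‖y‖`. [folklore] -/
theorem sqrt_linkNormSq_le_norm (y : ZM) (j : Fin 3) : Real.sqrt (linkNormSq y j) ≤ ‖y‖ := by
  have h1 : ‖y‖ ^ 2 = ∑ p : Fin 3 × Fin 3, y p ^ 2 := by
    rw [EuclideanSpace.norm_eq, Real.sq_sqrt (Finset.sum_nonneg fun _ _ => sq_nonneg _)]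
    exact Finset.sum_congr rfl fun p _ => by rw [Real.norm_eq_abs, sq_abs]
  have h2 : linkNormSq y j ≤ ‖y‖ ^ 2 := by
    rw [h1, Fintype.sum_prod_type]
    exact Finset.single_le_sum (f := fun j' => ∑ a : Fin 3, y (j', a) ^ 2) (fun _ _ => Finset.sum_nonneg fun _ _ => sq_nonneg _)
      (Finset.mem_univ j)
  calc Real.sqrt (linkNormSq y j) ≤ Real.sqrt (‖y‖ ^ 2) := Real.sqrt_le_sqrt h2
    _ = ‖y‖ := Real.sqrt_sq (norm_nonneg _)

/-- A non-empty open subset of `ℝ⁹` contains a point all of whose link vectors are non-zero (the coordinate hyperplanes are Lebesgue-null). [folklore] -/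
theorem exists_regular_point {O : Set ZM} (hO : IsOpen O) (hne : O.Nonempty) : ∃ y ∈ O, ∀ j : Fin 3, 0 < linkNormSq y j := by
  by_contra hcon
  have hcon' : ∀ y ∈ O, ∃ j : Fin 3, linkNormSq y j = 0 := by
    intro y hy
    by_contra h
    refine hcon ⟨y, hy, fun j => lt_of_le_of_ne (linkNormSq_nonneg y j) fun h0 => h ⟨j, h0.symm⟩⟩
  -- the hyperplanes `y_{(j,0)} = 0`
  set K : Fin 3 → Submodule ℝ ZM := fun j =>
    LinearMap.ker (PiLp.proj 2 (𝕜 := ℝ) (fun _ : Fin 3 × Fin 3 => ℝ) (j, (0 : Fin 3))).toLinearMap with hK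
  have hKmem : ∀ j (y : ZM), y ∈ K j ↔ y (j, 0) = 0 := fun j y => by
    rw [hK, LinearMap.mem_ker]
    rfl
  have hKtop : ∀ j, K j ≠ ⊤ := fun j h => by
    have hmem : EuclideanSpace.single (j, (0 : Fin 3)) (1 : ℝ) ∈ K j := by rw [h]; exact Submodule.mem_top
    rw [hKmem] at hmem
    simp at hmem
  have hKnull : ∀ j, volume (K j : Set ZM) = 0 := fun j => Measure.addHaar_submodule volume (K j) (hKtop j)
  have hsub : O ⊆ ⋃ j, (K j : Set ZM) := by
    intro y hy
    obtain ⟨j, hj⟩ := hcon' y hy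
    have h0 : y (j, 0) ^ 2 = 0 := by
      have hsum : ∑ a : Fin 3, y (j, a) ^ 2 = 0 := hj
      exact (Finset.sum_eq_zero_iff_of_nonneg (fun a _ => sq_nonneg (y (j, a)))).1 hsum 0 (Finset.mem_univ _)
    refine Set.mem_iUnion.2 ⟨j, ?_⟩
    show y ∈ K j
    rw [hKmem]
    exact pow_eq_zero_iff two_ne_zero |>.1 h0
  have hOnull : volume O = 0 := measure_mono_null hsub ((measure_iUnion_null_iff).2 hKnull)
  exact absurd hOnull (hO.measure_pos volume hne).ne'

end Summit.QuantumFields.YangMills.Theorems.FemtoTransferGap.PolyakovLift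

end
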